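import Summits.ResolutionOfSingularities.ResolutionOfSingularities.Theorems.RadicialJungCleanModelsStubCompletionDerivationParam
import Literature.FieldTheory.Separability.FormallySmoothAlgebraic
import HarnessLib

/-!
# Stub `stub_completionDerivationUnit` for crux stmt-ResolutionOfSingularities-15917
(`RadicialJung.CleanModels`)

For a regular local ring `O` of prime characteristic `p` and a unit `u ∈ O` whose residue class
is not a `p`-th power (`u - c^p ∉ 𝔪` for all `c ∈ O`), the `𝔪`-adic completion `Ô` carries a
`ℤ`-derivation `D` with `D(u)` a unit.

Proof: Cohen coordinates `e : Ô ≃+* κ⟦X_1, …, X_d⟧` (`κ = O/𝔪`, the tree's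
`exists_ringEquiv_adicCompletion_mvPowerSeries_of_rsop` applied to a regular system of
parameters and the prime field `𝔽_p ⊆ O`). The ring map `ρ = (constant term) ∘ e : Ô → κ` kills
`𝔪̂` and every element of `κ` is `ρ(c)` for some `c ∈ O` (the residue field of `Ô` is that of
`O`), so `a = ρ(u)` is not a `p`-th power in `κ`: `a = ρ(c)^p` would make the unit `u - c^p` map
to `0`. By the weak `p`-basis theorem (`exists_derivation_apply_eq_one_of_forall_pow_ne`) some
derivation `D₀` of `κ` has `D₀(a) = 1`; its coefficientwise extension `D₁` to `κ⟦X⟧`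
(`exists_derivation_mvPowerSeries_coeff`) sends `e(u)` to a series with constant term `1`, a
unit, and `D` is the transport of `D₁` along `e` (`exists_derivation_ringEquiv_transport`).
-/

noncomputable section

set_option linter.dupNamespace false

open IsLocalRing Literature.AlgebraicGeometry.Resolution

namespace Summit.ResolutionOfSingularities.ResolutionOfSingularities.Theorems.RadicialJung.CleanModels

universe u

/-- **Coefficientwise extension of a derivation to power series.** A `ℤ`-derivation `D₀` of a
commutative ring `K` extends to a `ℤ`-derivation `D₁` of `K⟦X_σ⟧` acting on each coefficient:
`coeff n (D₁ f) = D₀ (coeff n f)` (the Leibniz rule follows from the Cauchy product formula). -/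
theorem exists_derivation_mvPowerSeries_coeff {σ : Type*} {K : Type*} [CommRing K]
    (D₀ : Derivation ℤ K K) :
    ∃ D₁ : Derivation ℤ (MvPowerSeries σ K) (MvPowerSeries σ K),
      ∀ f n, MvPowerSeries.coeff n (D₁ f) = D₀ (MvPowerSeries.coeff n f) := by
  classical
  -- the coefficientwise map as an additive homomorphism
  let T : MvPowerSeries σ K →+ MvPowerSeries σ K :=
    AddMonoidHom.mk' (fun f => fun n => D₀ (f n)) fun f g => funext fun n => map_add D₀ (f n) (g n)
  have hT : ∀ f n, MvPowerSeries.coeff n (T f) = D₀ (MvPowerSeries.coeff n f) := fun _ _ => rfl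
  -- Leibniz rule, from the Cauchy product
  have hmul : ∀ f g : MvPowerSeries σ K, T (f * g) = f * T g + g * T f := fun f g =>
    MvPowerSeries.ext fun n => by
      rw [hT, MvPowerSeries.coeff_mul, map_sum, map_add, MvPowerSeries.coeff_mul, mul_comm g,
        MvPowerSeries.coeff_mul, ← Finset.sum_add_distrib]
      refine Finset.sum_congr rfl fun x _ => ?_
      rw [Derivation.leibniz, smul_eq_mul, smul_eq_mul, hT, hT,
        mul_comm (MvPowerSeries.coeff x.2 g)]
  have h1 : T 1 = 0 := MvPowerSeries.ext fun n => by
    rw [hT, MvPowerSeries.coeff_one, map_zero]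
    split_ifs
    exacts [D₀.map_one_eq_zero, map_zero D₀]
  -- integers are killed
  have hint : ∀ n : ℤ, T (n : MvPowerSeries σ K) = 0 := fun n => by
    rw [← zsmul_one, map_zsmul, h1, smul_zero]
  refine ⟨{ toFun := T
            map_add' := map_add T
            map_smul' := fun n f => by
              rw [RingHom.id_apply, Algebra.smul_def, eq_intCast, hmul, hint, mul_zero, add_zero,
                zsmul_eq_mul]
            map_one_eq_zero' := by
              change T 1 = 0
              exact h1
            leibniz' := fun f g => by
              change T (f * g) = f * T g + g * T f
              exact hmul f g }, fun f n => rfl⟩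

/-- **A derivation of the completion making a residually non-`p`-th-power unit into a unit.**
For a regular local ring `O` of prime characteristic `p` and `u ∈ O` with `u - c^p ∉ 𝔪` for
every `c ∈ O` (the residue of `u` is not a `p`-th power), the `𝔪`-adic completion `Ô` carries a
derivation `D` with `D(u)` a unit (Cohen: `Ô ≅ κ⟦X⟧` for the residue field `κ`; a derivation `D₀`
of `κ` with `D₀(ū) = 1` exists by the weak `p`-basis theorem since `ū ∉ κ^p`, and its
coefficientwise extension to `κ⟦X⟧` sends `u` to a series with constant term `1`). -/
theorem stub_completionDerivationUnit {O : Type u} [CommRing O] [IsRegularLocalRing O] (p : ℕ)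
    [Fact p.Prime] [CharP O p] (u : O) (hu : ∀ c : O, u - c ^ p ∉ maximalIdeal O) :
    ∃ D : Derivation ℤ (AdicCompletion (maximalIdeal O) O) (AdicCompletion (maximalIdeal O) O),
      IsUnit (D (algebraMap O (AdicCompletion (maximalIdeal O) O) u)) := by
  set A := AdicCompletion (maximalIdeal O) O with hA
  -- the prime field `𝔽_p` inside `O`
  let φ : ZMod p →+* O := ZMod.castHom (dvd_refl p) O
  have hφ : Function.Injective φ := φ.injective
  let k₀ : Subring O := φ.range
  have hk₀ : IsField k₀ :=
    MulEquiv.isField (Field.toIsField (ZMod p)) (RingEquiv.ofBijective φ.rangeRestrict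
      ⟨fun a b h => hφ (congrArg Subtype.val h), φ.rangeRestrict_surjective⟩).symm.toMulEquiv
  haveI : CharP (ResidueField O) p :=
    (RingHom.charP_iff_charP ((residue O).comp φ) p).mp inferInstance
  -- a regular system of parameters and Cohen coordinates `e : Ô ≃ κ⟦X⟧`
  obtain ⟨t, ht⟩ := exists_regularSystemOfParameters (R := O)
  have hd : ringKrullDim O = ((maximalIdeal O).spanFinrank : ℕ) :=
    (IsRegularLocalRing.spanFinrank_maximalIdeal (R := O)).symm
  obtain ⟨e, -⟩ := exists_ringEquiv_adicCompletion_mvPowerSeries_of_rsop O k₀ hk₀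
    (RingEquiv.refl (ResidueField O)) t ht hd
  -- the residue map in coordinates: `ρ = (constant term) ∘ e`
  let ρ : A →+* ResidueField O := MvPowerSeries.constantCoeff.comp e.toRingHom
  have hρ : ∀ x, ρ x = MvPowerSeries.constantCoeff (e x) := fun x => rfl
  -- `ρ` kills the maximal ideal of `Ô`
  have hρm : ∀ m ∈ maximalIdeal A, ρ m = 0 := fun m hm => by
    by_contra h0
    have h1 : IsUnit (e m) :=
      MvPowerSeries.isUnit_iff_constantCoeff.mpr (isUnit_iff_ne_zero.mpr h0)
    have h2 := h1.map e.symm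
    rw [RingEquiv.symm_apply_apply] at h2
    exact (mem_nonunits_iff.mp ((IsLocalRing.mem_maximalIdeal m).mp hm)) h2
  -- every element of `κ` is the residue of an element of `O`
  have hρs : ∀ b : ResidueField O, ∃ c : O, ρ (algebraMap O A c) = b := fun b => by
    obtain ⟨y, hy⟩ := (AdicCompletion.residueField_map_bijective O).2
      (residue A (e.symm (MvPowerSeries.C b)))
    obtain ⟨c, rfl⟩ := residue_surjective y
    refine ⟨c, ?_⟩
    rw [IsLocalRing.ResidueField.map_residue] at hy
    have hmem : algebraMap O A c - e.symm (MvPowerSeries.C b) ∈ maximalIdeal A := by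
      rw [← residue_eq_zero_iff, map_sub, sub_eq_zero]
      exact hy
    have h0 := hρm _ hmem
    rw [map_sub, sub_eq_zero] at h0
    rw [h0, hρ, RingEquiv.apply_symm_apply, MvPowerSeries.constantCoeff_C]
  -- the residue `a = ρ(u)` of `u` is not a `p`-th power in `κ`
  have ha : ∀ b : ResidueField O, b ^ p ≠ ρ (algebraMap O A u) := fun b hb => by
    obtain ⟨c, hc⟩ := hρs b
    have hunit : IsUnit (u - c ^ p) := by
      by_contra hnu
      exact hu c ((IsLocalRing.mem_maximalIdeal _).mpr (mem_nonunits_iff.mpr hnu))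
    have h1 : IsUnit (ρ (algebraMap O A (u - c ^ p))) := (hunit.map _).map _
    rw [map_sub, map_pow, map_sub, map_pow, hc, hb, sub_self] at h1
    exact not_isUnit_zero h1
  -- weak `p`-basis theorem: a derivation `D₀` of `κ` with `D₀ a = 1`
  obtain ⟨D₀, hD₀⟩ :=
    Literature.FieldTheory.Separability.exists_derivation_apply_eq_one_of_forall_pow_ne p _ ha
  -- its coefficientwise extension to `κ⟦X⟧`, transported back along `e`
  obtain ⟨D₁, hD₁⟩ := exists_derivation_mvPowerSeries_coeff (σ := Fin _) D₀
  have key : IsUnit (MvPowerSeries.constantCoeff (D₁ (e (algebraMap O A u)))) := by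
    rw [← MvPowerSeries.coeff_zero_eq_constantCoeff_apply, hD₁,
      MvPowerSeries.coeff_zero_eq_constantCoeff_apply, ← hρ, hD₀]
    exact isUnit_one
  obtain ⟨D, hD⟩ := exists_derivation_ringEquiv_transport D₁ e.symm
  refine ⟨D, ?_⟩
  rw [hD, RingEquiv.symm_symm]
  exact (MvPowerSeries.isUnit_iff_constantCoeff.mpr key).map e.symm

end Summit.ResolutionOfSingularities.ResolutionOfSingularities.Theorems.RadicialJung.CleanModels

end
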